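import Summits.QuantumFields.YangMills.Theorems.IR.LevelwiseDominationKernel
import Summits.QuantumFields.YangMills.Theorems.BalabanLadderIRcofTemporalTwistSubadditivity
import HarnessLib

/-!
# Sketch — crux idea «flux-interlacing» for `IRcof` (stmt-QuantumFields-26930), seat ymfull-r2c-lens-2-g1 (lens-2 DISORDER∕CENTRE, re-framed
as LENS IDEATOR B «reformulation ∕ transfer + extremal structure»).

HONEST LABEL: finite-volume ∕ conditional bookkeeping; nothing here proves `PinnedExitsCofinalAt (1/24)`, `IRnscCof`, `IRcof`, `IR`, or the
Clay Yang–Mills mass gap (NOT proved anywhere in this tree).  bears_on: R2c.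

CONTENT (all sorry-free):
* §1 currency (re-using the LANDED e-projection `TemporalTwistSubadditivity.projZ ∕ projDefect`): `IsProjDatum`, `InterlacedAt`
  (the charged trace of the cold box is controlled by the EXCITED part of the neutral trace), and the two cofinal Props
  `NeutralPurityCof` (V: pinned cofinal purity of SOME flux projection — the declared residual, weaker BY NAME than
  `∀ θ, PinnedExitsCofinalAt θ`) and `FluxInterlacingEv` (I: the lever — at every weak coupling, a box whose NEUTRAL sector is
  ε₀-pure is interlaced: centre flux is heavier than the neutral gap; no floor, no unit map, `∃ κ ε₀ β₀` AFTER `∀ r`).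
* §2 the real-number conversion `defect_le_of_proj_interlaced` and the one-box theorem `coldDefect_le_of_projPure_interlaced`:
  `projDefect ≤ ε ∧ InterlacedAt κ ⇒ coldDefect ≤ (1 + 2κ) ε`.
* §3 compositions BY NAME: `pinnedExitsCofinal_of_neutral_interlacing : NeutralPurityCof → FluxInterlacingEv → PinnedExitsCofinalAt (1/24)`
  and `IRcof_of_neutral_interlacing : … → IRnscCof → BalabanLadder.IRcof` (via the landed `LevelwiseDomination.IRcof_of_pinnedExitsCofinalAt`).
* §4 weakness certificate `neutralPurityCof_of_pxcofAll` (V ⇐ PXcof at every θ, with the trivial projection `z = 1`), and two toys: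
  `not_interlaced_of_light_flux` (the finite-group ∕ topologically ordered spectral configuration — pure neutral sector, `m ≥ 2`
  degenerate flux vacua — violates interlacing for EVERY κ: the dictionary entry «I is false for ℤ_N») and `interlaced_of_charged_le_excited` ∕ `charged_le_excited_of_interlaced`
  (the trace form is sandwiched between «charged ≤ (κ∕2)·excited-neutral» and «charged ≤ κ·excited-neutral»).
-/

set_option autoImplicit false

noncomputable section

open Filter Topology MeasureTheory
open scoped BigOperators
open Literature.MathematicalPhysics.QuantumFieldTheory Literature.MathematicalPhysics.QuantumLattice
open Summit.QuantumFields.YangMills.Cruxes.OSLegsFromFemtoAndGap.DlrCollarTransfer (LowerBounds)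
open Summit.QuantumFields.YangMills.Cruxes.IR.ColdPurityBridge (coldDefect)
open Summit.QuantumFields.YangMills.Cruxes.IR.RankPurity (IRnscCof)
open Summit.QuantumFields.YangMills.Cruxes.IRcof.RunningLandmark (PinnedExitsCofinalAt)
open Summit.QuantumFields.YangMills.Cruxes.IRcof.TemporalTwistSubadditivity (eTwist projZ projDefect eTwist_center)

namespace Summit.QuantumFields.YangMills.Cruxes.IRcof.FluxInterlacing

/-! ## §1 Currency -/

section Defs

variable {G : Type} [Group G] [TopologicalSpace G] [IsTopologicalGroup G] [CompactSpace G]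
  [MeasurableSpace G] [BorelSpace G]

/-- **Projection datum**: a central `z` of exponent `n ≥ 1` (`z ^ n = 1`); the e-projection `projZ ρ β z n` averages the cold box over
the finite abelian twist group `⟨z⟩³` in the three temporal planes = the trace of `𝒯^t` over the electric fluxes annihilated by `⟨z⟩³`
('t Hooft 1979 (5.2)–(5.4)); `z` generating `Z(SU(N))` gives the zero-flux (neutral) sector, `z = 1` gives everything. -/
def IsProjDatum (z : G) (n : ℕ) : Prop :=
  z ∈ Subgroup.center G ∧ 0 < n ∧ z ^ n = 1

/-- **Interlacing of the cold box at scale `L`** (trace form of «centre flux is heavier than the neutral gap»): with `t = ⌊L/4⌋`,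
`A_t = projZ (…) t` the projected (neutral) trace and `Z_t` the full trace,
`Z_t ≤ A_t + κ · (A_t − √A_{2t})` — the CHARGED trace `Z_t − A_t` is at most `κ` times the proxy `A_t − √A_{2t} (≥ A_t − λ₀^t ≥ 0)` for
the EXCITED part of the neutral trace.  In a confined box (flux energies `≍ σ L · t ≫ m t`) it holds with room; in a topologically ordered
box (pure neutral sector, light flux) it fails for every `κ` (`not_interlaced_of_light_flux`). -/
def InterlacedAt {N : ℕ} (ρ : G →* Matrix (Fin N) (Fin N) ℂ) (β : ℝ) (z : G) (n : ℕ) (κ : ℝ) (L : ℕ) : Prop :=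
  wilsonFinTorusPartition ρ β L L L (L / 4) ≤
    projZ ρ β z n L (L / 4) + κ * (projZ ρ β z n L (L / 4) - Real.sqrt (projZ ρ β z n L (2 * (L / 4))))

end Defs

/-- **V — `NeutralPurityCof` (RESIDUAL, declared; weaker BY NAME than `∀ θ > 0, PinnedExitsCofinalAt θ` via `z = 1`,
`neutralPurityCof_of_pxcofAll`)**: for simply-connected simple `G`, every faithful `r`, every admissible unit map `a` with the floor
`LowerBounds`, and every `ε > 0`: boxes of bounded physical size `a β · L ≤ T(ε)` whose cold period-doubling defect PROJECTED to the
fluxes annihilated by some `⟨z⟩³` is `≤ ε`, cofinally in `β`.  The intended witness is `z` generating the centre (the NEUTRAL sector: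
no statement about flux ∕ confinement at all — B2's centre-blind vacuum half, isolated). -/
def NeutralPurityCof : Prop :=
  ∀ (G : Type) [Group G] [TopologicalSpace G] [IsTopologicalGroup G] [CompactSpace G],
    IsCompactSimpleLieGroup G → SimplyConnectedSpace G →
    letI : MeasurableSpace G := borel G
    haveI : BorelSpace G := ⟨rfl⟩
    ∀ (r : LatticeRep G) (a : ℝ → ℝ), (∀ β, 0 < a β) → Tendsto a atTop (𝓝 0) → LowerBounds G r a →
      ∀ ε : ℝ, 0 < ε → ∃ T : ℝ, ∀ β₁ : ℝ, ∃ β : ℝ, β₁ ≤ β ∧ ∃ L : ℕ, 8 ≤ L ∧ a β * (L : ℝ) ≤ T ∧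
        ∃ (z : G) (n : ℕ), IsProjDatum z n ∧ projDefect r.ρ β z n L (L / 4) ≤ ε

/-- **I — `FluxInterlacingEv` (the LEVER; skew to PXcof; IDEA-NEEDED)**: «for Lie groups there is no gapped deconfined phase»:
for simply-connected simple `G` and faithful `r` there are `κ ≥ 0`, `ε₀ > 0`, `β₀` (AFTER `∀ r`: no `r`-uniformity, B1) such that at
every `β ≥ β₀` and every `L ≥ 8`, a cold box whose `⟨z⟩³`-projected defect is `≤ ε₀` is `κ`-interlaced.  No floor, no unit map, no
`a`: a pure weak-coupling statement about single boxes, vacuous wherever gluons are light in lattice units (the whole femto ∕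
perturbative window at fixed `L`, the Coulomb phase of `U(1)`), FALSE for finite gauge groups (frozen topological order), claimed only
for connected simply-connected `G`. -/
def FluxInterlacingEv : Prop :=
  ∀ (G : Type) [Group G] [TopologicalSpace G] [IsTopologicalGroup G] [CompactSpace G],
    IsCompactSimpleLieGroup G → SimplyConnectedSpace G →
    letI : MeasurableSpace G := borel G
    haveI : BorelSpace G := ⟨rfl⟩
    ∀ r : LatticeRep G, ∃ κ ε₀ β₀ : ℝ, 0 ≤ κ ∧ 0 < ε₀ ∧ ∀ β : ℝ, β₀ ≤ β → ∀ L : ℕ, 8 ≤ L →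
      ∀ (z : G) (n : ℕ), IsProjDatum z n → projDefect r.ρ β z n L (L / 4) ≤ ε₀ → InterlacedAt r.ρ β z n κ L

/-- **I_sc — the strong-coupling rung of the lever (ATTACKABLE leaf, cluster expansion; not used by the composition)**: at small
`β ≥ 0` every cold box is `κ`-interlaced outright (flux free energy `≍ −log β · L · t`, neutral gap `≍ −4 log β`: Osterwalder–Seiler 1978,
Münster 1981), with NO purity hypothesis.  Non-vacuity witness for the conclusion shape of `FluxInterlacingEv`. -/
def InterlacingSC : Prop :=
  ∀ (G : Type) [Group G] [TopologicalSpace G] [IsTopologicalGroup G] [CompactSpace G],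
    IsCompactSimpleLieGroup G → SimplyConnectedSpace G →
    letI : MeasurableSpace G := borel G
    haveI : BorelSpace G := ⟨rfl⟩
    ∀ r : LatticeRep G, ∃ κ βs : ℝ, 0 ≤ κ ∧ 0 < βs ∧ ∀ β : ℝ, 0 ≤ β → β ≤ βs → ∀ L : ℕ, 8 ≤ L →
      ∀ (z : G) (n : ℕ), IsProjDatum z n → InterlacedAt r.ρ β z n κ L

/-! ## §2 The conversion: neutral purity + interlacing ⇒ full purity (one box) -/

/-- **Real-number core.** `A₁, A₂` = projected traces at `t, 2t`; `Z₁, Z₂` = full traces.  Domination `A₂ ≤ Z₂`, neutral purity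
`1 − A₂/A₁² ≤ ε ≤ 1`, interlacing `Z₁ ≤ A₁ + κ (A₁ − √A₂)` give `1 − Z₂/Z₁² ≤ (1 + 2κ) ε`.
(`√A₂ ≥ (1−ε) A₁ ⇒ Z₁ ≤ (1+κε) A₁`; `Z₂ ≥ (1−ε) A₁²`; `(1 − (1+2κ)ε)(1+κε)² ≤ 1 − ε`.) -/
theorem defect_le_of_proj_interlaced {Z₁ Z₂ A₁ A₂ κ ε : ℝ} (hA₁ : 0 < A₁) (hZ₁ : 0 < Z₁) (hκ : 0 ≤ κ)
    (hε0 : 0 ≤ ε) (hε1 : ε ≤ 1) (hdom : A₂ ≤ Z₂) (hV : 1 - A₂ / A₁ ^ 2 ≤ ε)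
    (hI : Z₁ ≤ A₁ + κ * (A₁ - Real.sqrt A₂)) :
    1 - Z₂ / Z₁ ^ 2 ≤ (1 + 2 * κ) * ε := by
  have hA₁sq : 0 < A₁ ^ 2 := by positivity
  -- neutral purity: A₂ ≥ (1 - ε) A₁²
  have hA₂ : (1 - ε) * A₁ ^ 2 ≤ A₂ := by
    have h1 : 1 - ε ≤ A₂ / A₁ ^ 2 := by linarith
    exact (le_div_iff₀ hA₁sq).1 h1
  have hA₂nn : 0 ≤ A₂ := le_trans (by nlinarith) hA₂
  -- √A₂ ≥ (1 - ε) A₁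
  have hsq : (1 - ε) * A₁ ≤ Real.sqrt A₂ := by
    have hx : 0 ≤ (1 - ε) * A₁ := mul_nonneg (by linarith) hA₁.le
    have hx2 : ((1 - ε) * A₁) ^ 2 ≤ A₂ := by
      have : ((1 - ε) * A₁) ^ 2 = (1 - ε) * ((1 - ε) * A₁ ^ 2) := by ring
      rw [this]
      calc (1 - ε) * ((1 - ε) * A₁ ^ 2) ≤ 1 * ((1 - ε) * A₁ ^ 2) :=
            mul_le_mul_of_nonneg_right (by linarith) (by nlinarith)
        _ = (1 - ε) * A₁ ^ 2 := one_mul _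
        _ ≤ A₂ := hA₂
    calc (1 - ε) * A₁ = Real.sqrt (((1 - ε) * A₁) ^ 2) := (Real.sqrt_sq hx).symm
      _ ≤ Real.sqrt A₂ := Real.sqrt_le_sqrt hx2
  -- interlacing: Z₁ ≤ (1 + κ ε) A₁
  have hZ₁le : Z₁ ≤ (1 + κ * ε) * A₁ := by
    have h1 : A₁ - Real.sqrt A₂ ≤ ε * A₁ := by linarith
    have h2 : κ * (A₁ - Real.sqrt A₂) ≤ κ * (ε * A₁) := mul_le_mul_of_nonneg_left h1 hκ
    nlinarith
  have hZ₁sq : Z₁ ^ 2 ≤ (1 + κ * ε) ^ 2 * A₁ ^ 2 := by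
    rw [← mul_pow]
    exact pow_le_pow_left₀ hZ₁.le hZ₁le 2
  -- the polynomial inequality
  have hu : 0 ≤ κ * ε := mul_nonneg hκ hε0
  have key : (1 - (1 + 2 * κ) * ε) * (1 + κ * ε) ^ 2 ≤ 1 - ε := by
    nlinarith [mul_nonneg hu hε0, mul_nonneg (mul_nonneg hu hu) hε0, mul_nonneg hu hu,
      mul_nonneg (mul_nonneg hu hu) hu]
  -- conclude: (1 - (1+2κ)ε) Z₁² ≤ Z₂
  have hZ₂ : (1 - (1 + 2 * κ) * ε) * Z₁ ^ 2 ≤ Z₂ := by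
    by_cases hs : 0 ≤ 1 - (1 + 2 * κ) * ε
    · calc (1 - (1 + 2 * κ) * ε) * Z₁ ^ 2 ≤ (1 - (1 + 2 * κ) * ε) * ((1 + κ * ε) ^ 2 * A₁ ^ 2) :=
            mul_le_mul_of_nonneg_left hZ₁sq hs
        _ = ((1 - (1 + 2 * κ) * ε) * (1 + κ * ε) ^ 2) * A₁ ^ 2 := by ring
        _ ≤ (1 - ε) * A₁ ^ 2 := mul_le_mul_of_nonneg_right key hA₁sq.le
        _ ≤ Z₂ := hA₂.trans hdom
    · have h1 : (1 - (1 + 2 * κ) * ε) * Z₁ ^ 2 ≤ 0 :=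
        mul_nonpos_of_nonpos_of_nonneg (le_of_lt (not_le.1 hs)) (sq_nonneg _)
      linarith [hA₂nn.trans hdom]
  have hZ₁sq0 : 0 < Z₁ ^ 2 := by positivity
  have h3 : 1 - (1 + 2 * κ) * ε ≤ Z₂ / Z₁ ^ 2 := (le_div_iff₀ hZ₁sq0).2 hZ₂
  linarith

section OneBox

variable {G : Type} [Group G] [TopologicalSpace G] [IsTopologicalGroup G] [CompactSpace G]
  [MeasurableSpace G] [BorelSpace G] [SecondCountableTopology G] {N : ℕ} {ρ : G →* Matrix (Fin N) (Fin N) ℂ}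

/-- The projected trace is positive (`n ≥ 1`). -/
theorem projZ_pos (hρ : Continuous ρ) (β : ℝ) (z : G) {n : ℕ} (hn : 0 < n) (L t : ℕ) : 0 < projZ ρ β z n L t := by
  unfold projZ
  haveI : NeZero n := ⟨Nat.pos_iff_ne_zero.1 hn⟩
  haveI : Nonempty (Fin 3 → Fin n) := ⟨fun _ => 0⟩
  refine mul_pos (inv_pos.2 ?_) (Finset.sum_pos (fun k _ => wilsonFinTorusTensorTwistedPartition_pos ρ hρ β _ _ _ _ _)
    Finset.univ_nonempty)
  exact_mod_cast Fintype.card_pos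

/-- Domination of the projected trace by the full trace (`A ≤ Z`; every central twist is dominated, tree
`wilsonFinTorusTensorTwistedPartition_le_partition`), for boxes `L ≥ 2` in space and `t ≥ 2` in time. -/
theorem projZ_le_partition (hρ : Continuous ρ) (hρu : ∀ g, ρ g ∈ Matrix.unitaryGroup (Fin N) ℂ) {β : ℝ} (hβ : 0 ≤ β)
    {z : G} (hz : z ∈ Subgroup.center G) {n : ℕ} (hn : 0 < n) {L t : ℕ} (hL : 2 ≤ L) (ht : 2 ≤ t) :
    projZ ρ β z n L t ≤ wilsonFinTorusPartition ρ β L L L t := by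
  unfold projZ
  haveI : NeZero n := ⟨Nat.pos_iff_ne_zero.1 hn⟩
  have hcard : (0 : ℝ) < ((Fintype.card (Fin 3 → Fin n) : ℕ) : ℝ) := by
    haveI : Nonempty (Fin 3 → Fin n) := ⟨fun _ => 0⟩
    exact_mod_cast Fintype.card_pos
  have hle : ∑ k : Fin 3 → Fin n, wilsonFinTorusTensorTwistedPartition ρ β (eTwist z k) L L L t ≤
      ∑ _k : Fin 3 → Fin n, wilsonFinTorusPartition ρ β L L L t :=
    Finset.sum_le_sum fun k _ =>
      wilsonFinTorusTensorTwistedPartition_le_partition ρ hρ hρu hβ (fun μ ν _ => eTwist_center hz k μ ν) hL hL ht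
  rw [Finset.sum_const, Finset.card_univ, nsmul_eq_mul] at hle
  calc ((Fintype.card (Fin 3 → Fin n) : ℕ) : ℝ)⁻¹ * ∑ k : Fin 3 → Fin n,
          wilsonFinTorusTensorTwistedPartition ρ β (eTwist z k) L L L t
        ≤ ((Fintype.card (Fin 3 → Fin n) : ℕ) : ℝ)⁻¹ *
          (((Fintype.card (Fin 3 → Fin n) : ℕ) : ℝ) * wilsonFinTorusPartition ρ β L L L t) :=
        mul_le_mul_of_nonneg_left hle (inv_nonneg.2 hcard.le)
    _ = wilsonFinTorusPartition ρ β L L L t := by rw [← mul_assoc, inv_mul_cancel₀ hcard.ne', one_mul]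

/-- ★ **One box: neutral purity + interlacing ⇒ purity.**  `projDefect ≤ ε ≤ 1` and `InterlacedAt κ` give
`coldDefect ≤ (1 + 2κ) ε` (`L ≥ 8`, `β ≥ 0`, continuous unitary `ρ`, central `z` of exponent `n ≥ 1`). -/
theorem coldDefect_le_of_projPure_interlaced (hρ : Continuous ρ) (hρu : ∀ g, ρ g ∈ Matrix.unitaryGroup (Fin N) ℂ)
    {β : ℝ} (hβ : 0 ≤ β) {L : ℕ} (hL : 8 ≤ L) {z : G} {n : ℕ} (hzn : IsProjDatum z n)
    {κ ε : ℝ} (hκ : 0 ≤ κ) (hε0 : 0 ≤ ε) (hε1 : ε ≤ 1)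
    (hV : projDefect ρ β z n L (L / 4) ≤ ε) (hI : InterlacedAt ρ β z n κ L) :
    coldDefect ρ β L ≤ (1 + 2 * κ) * ε := by
  have hL2 : 2 ≤ L := by omega
  have ht2 : 2 ≤ 2 * (L / 4) := by omega
  unfold coldDefect
  unfold projDefect at hV
  unfold InterlacedAt at hI
  exact defect_le_of_proj_interlaced (projZ_pos hρ β z hzn.2.1 L (L / 4))
    (wilsonFinTorusPartition_pos hρ β L L L (L / 4)) hκ hε0 hε1
    (projZ_le_partition hρ hρu hβ hzn.1 hzn.2.1 hL2 ht2) hV hI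

end OneBox

/-! ## §3 Compositions BY NAME -/

/-- ★★ **V ∧ I ⇒ PXcof(1∕24)** (`RunningLandmark.PinnedExitsCofinalAt (1/24)`, the Theorems twin of the slot's registered stub
`PinnedCofinalBill.stub_pinnedExitsCofinal`).  `ε := min ε₀ (1 / (24 (1 + 2κ)))` with `κ, ε₀, β₀` from I; V supplies the pinned box. -/
theorem pinnedExitsCofinal_of_neutral_interlacing (hV : NeutralPurityCof) (hI : FluxInterlacingEv) :
    PinnedExitsCofinalAt (1 / 24) := by
  intro G _ _ _ _ hG hsc
  letI : MeasurableSpace G := borel G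
  haveI : BorelSpace G := ⟨rfl⟩
  intro r a ha ha0 hlb
  obtain ⟨κ, ε₀, β₀, hκ, hε₀, hIr⟩ := hI G hG hsc r
  have h24 : (0 : ℝ) < 24 * (1 + 2 * κ) := by positivity
  set ε : ℝ := min ε₀ (1 / (24 * (1 + 2 * κ))) with hεdef
  have hεpos : 0 < ε := lt_min hε₀ (by positivity)
  have hεle₀ : ε ≤ ε₀ := min_le_left _ _
  have hεle : ε ≤ 1 / (24 * (1 + 2 * κ)) := min_le_right _ _
  have hε1 : ε ≤ 1 := by
    refine hεle.trans ?_
    rw [div_le_iff₀ h24]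
    nlinarith
  obtain ⟨T, hT⟩ := hV G hG hsc r a ha ha0 hlb ε hεpos
  refine ⟨T, fun β₁ => ?_⟩
  obtain ⟨β, hβ, L, hL, haL, z, n, hzn, hproj⟩ := hT (max β₁ (max β₀ 0))
  have hβ₁ : β₁ ≤ β := le_trans (le_max_left _ _) hβ
  have hβ₀ : β₀ ≤ β := le_trans ((le_max_left _ _).trans (le_max_right _ _)) hβ
  have hβ0 : 0 ≤ β := le_trans ((le_max_right _ _).trans (le_max_right _ _)) hβ
  haveI : SecondCountableTopology G :=
    (r.continuous.isClosedEmbedding r.injective).isEmbedding.secondCountableTopology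
  have hint : InterlacedAt r.ρ β z n κ L := hIr β hβ₀ L hL z n hzn (hproj.trans hεle₀)
  have hcd := coldDefect_le_of_projPure_interlaced r.continuous r.mem_unitary hβ0 hL hzn hκ hεpos.le hε1 hproj hint
  refine ⟨β, hβ₁, L, hL, haL, ?_⟩
  show coldDefect r.ρ β L ≤ 1 / 24
  refine hcd.trans ?_
  calc (1 + 2 * κ) * ε ≤ (1 + 2 * κ) * (1 / (24 * (1 + 2 * κ))) := mul_le_mul_of_nonneg_left hεle (by positivity)
    _ = 1 / 24 := by
        have h12 : (1 + 2 * κ) ≠ 0 := by positivity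
        field_simp

/-- **V ∧ I ∧ N_cof ⇒ `IRcof` BY NAME** (through the landed `LevelwiseDomination.IRcof_of_pinnedExitsCofinalAt`). Conditional composition;
no hypothesis is proved anywhere. -/
theorem IRcof_of_neutral_interlacing (hV : NeutralPurityCof) (hI : FluxInterlacingEv) (hN : IRnscCof) :
    Summit.QuantumFields.YangMills.Theses.BalabanLadder.IRcof :=
  Summit.QuantumFields.YangMills.Cruxes.IR.LevelwiseDomination.IRcof_of_pinnedExitsCofinalAt
    (pinnedExitsCofinal_of_neutral_interlacing hV hI) hN

/-! ## §4 Weakness certificate and toys -/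

section Weakness

variable {G : Type} [Group G] [TopologicalSpace G] [IsTopologicalGroup G] [CompactSpace G]
  [MeasurableSpace G] [BorelSpace G] {N : ℕ}

/-- The trivial projection `z = 1, n = 1` is the full trace. -/
theorem projZ_one (ρ : G →* Matrix (Fin N) (Fin N) ℂ) (β : ℝ) (L t : ℕ) :
    projZ ρ β (1 : G) 1 L t = wilsonFinTorusPartition ρ β L L L t := by
  unfold projZ
  have h1 : ∀ k : Fin 3 → Fin 1, wilsonFinTorusTensorTwistedPartition ρ β (eTwist (1 : G) k) L L L t =
      wilsonFinTorusPartition ρ β L L L t := fun k =>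
    wilsonFinTorusTensorTwistedPartition_eq_partition_of_forall_eq_one ρ β (fun μ ν _ => by
      unfold eTwist; split_ifs <;> simp) L L L t
  simp only [h1, Finset.sum_const, Finset.card_univ, nsmul_eq_mul, Fintype.card_fun, Fintype.card_fin]
  norm_num

/-- `projDefect` at the trivial projection is the cold defect. -/
theorem projDefect_one (ρ : G →* Matrix (Fin N) (Fin N) ℂ) (β : ℝ) (L : ℕ) :
    projDefect ρ β (1 : G) 1 L (L / 4) = coldDefect ρ β L := by
  unfold projDefect coldDefect
  rw [projZ_one, projZ_one]

omit [TopologicalSpace G] [IsTopologicalGroup G] [CompactSpace G] [MeasurableSpace G] [BorelSpace G] in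
/-- `1` is a projection datum of exponent `1`. -/
theorem isProjDatum_one : IsProjDatum (1 : G) 1 := ⟨Subgroup.one_mem _, Nat.one_pos, one_pow 1⟩

end Weakness

section BetaZero

variable {G : Type} [Group G] [TopologicalSpace G] [IsTopologicalGroup G] [CompactSpace G]
  [MeasurableSpace G] [BorelSpace G] {N : ℕ} (ρ : G →* Matrix (Fin N) (Fin N) ℂ)

/-- **(N) non-vacuity of the hypothesis shape, in-model: at `β = 0` every projected trace is `1`** (Haar product, weight `e⁰`). -/
theorem projZ_beta_zero (z : G) {n : ℕ} (hn : 0 < n) (L t : ℕ) : projZ ρ 0 z n L t = 1 := by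
  unfold projZ
  haveI : NeZero n := ⟨Nat.pos_iff_ne_zero.1 hn⟩
  have hcard : ((Fintype.card (Fin 3 → Fin n) : ℕ) : ℝ) ≠ 0 := by
    haveI : Nonempty (Fin 3 → Fin n) := ⟨fun _ => 0⟩
    exact_mod_cast Fintype.card_pos.ne'
  have h1 : ∀ k : Fin 3 → Fin n, wilsonFinTorusTensorTwistedPartition ρ 0 (eTwist z k) L L L t = 1 := fun k => by
    simp [wilsonFinTorusTensorTwistedPartition, wilsonFinTorusPlaqTwistedPartition]
  simp only [h1, Finset.sum_const, Finset.card_univ, nsmul_eq_mul, mul_one]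
  exact inv_mul_cancel₀ hcard

/-- … hence the projected defect vanishes at `β = 0` (the hypothesis `projDefect ≤ ε₀` of `FluxInterlacingEv` is inhabited in-model), -/
theorem projDefect_beta_zero (z : G) {n : ℕ} (hn : 0 < n) (L : ℕ) : projDefect ρ 0 z n L (L / 4) = 0 := by
  unfold projDefect
  rw [projZ_beta_zero ρ z hn, projZ_beta_zero ρ z hn]
  norm_num

/-- … and the `β = 0` box is `κ`-interlaced for every `κ` (all flux sectors `e ≠ 0` have weight `0`: the extreme confined corner;
the conclusion shape of `FluxInterlacingEv` ∕ `InterlacingSC` is inhabited in-model). -/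
theorem interlacedAt_beta_zero (z : G) {n : ℕ} (hn : 0 < n) (κ : ℝ) (L : ℕ) : InterlacedAt ρ 0 z n κ L := by
  unfold InterlacedAt
  rw [projZ_beta_zero ρ z hn, projZ_beta_zero ρ z hn]
  simp [wilsonFinTorusPartition]

end BetaZero

/-- **PXcof at every threshold** (informational comparison Prop; stronger BY NAME than the slot's `PinnedExitsCofinalAt (1/24)`). -/
def PXcofAll : Prop := ∀ θ : ℝ, 0 < θ → PinnedExitsCofinalAt θ

/-- ★ **Weakness certificate: `(∀ θ > 0, PXcof θ) ⇒ V`** — the residual `NeutralPurityCof` asks no more than pinned cofinal purity at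
every threshold (witness `z = 1`); its INTENDED witness (the centre generator) asks for much less (no flux sector at all). -/
theorem neutralPurityCof_of_pxcofAll (h : PXcofAll) : NeutralPurityCof := by
  intro G _ _ _ _ hG hsc
  letI : MeasurableSpace G := borel G
  haveI : BorelSpace G := ⟨rfl⟩
  intro r a ha ha0 hlb ε hε
  obtain ⟨T, hT⟩ := h ε hε G hG hsc r a ha ha0 hlb
  refine ⟨T, fun β₁ => ?_⟩
  obtain ⟨β, hβ, L, hL, haL, hcd⟩ := hT β₁
  refine ⟨β, hβ, L, hL, haL, 1, 1, isProjDatum_one, ?_⟩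
  rw [projDefect_one]
  exact hcd

/-- **Toy (dictionary: finite gauge group ∕ topological order violates interlacing).**  If the neutral sector is exactly pure
(`A₂ = A₁²`) and the full trace carries `m ≥ 2` degenerate flux copies of it (`Z₁ = m · A₁`: light centre flux), the box is NOT
`κ`-interlaced for ANY `κ` — the frozen phase of a finite abelian gauge theory (|G|³ degenerate flux vacua, tree
`FreezingLimit` helpers p784277) in numbers. -/
theorem not_interlaced_of_light_flux {A₁ m κ : ℝ} (hA : 0 < A₁) (hm : 2 ≤ m) :
    ¬ (m * A₁ ≤ A₁ + κ * (A₁ - Real.sqrt (A₁ ^ 2))) := by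
  rw [Real.sqrt_sq hA.le, sub_self, mul_zero, add_zero]
  intro h
  nlinarith

/-- **Toy ∕ spectral reading (confined configuration satisfies interlacing).**  Write the neutral trace as vacuum + excited,
`A₁ = a₀ + X` (`a₀ = λ₀^t > 0`, `X ≥ 0`), use `A₂ ≤ a₀² + a₀ X` (every level `≤ λ₀`) and let the charged trace be `C = Z₁ − A₁`.
If `C ≤ (κ/2) · X` — «flux is at least as heavy as glue, up to multiplicity `κ/2`» — the box is `κ`-interlaced
(`√A₂ ≤ a₀ + X/2`, so the allowance `κ (A₁ − √A₂) ≥ κ X / 2`).  Conversely `InterlacedAt κ ⇒ C ≤ κ X` (`√A₂ ≥ a₀`): the trace form is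
sandwiched between the spectral statements with constants `κ/2` and `κ`. -/
theorem interlaced_of_charged_le_excited {Z₁ A₂ a₀ X C κ : ℝ} (hκ : 0 ≤ κ) (ha₀ : 0 < a₀) (hX : 0 ≤ X)
    (hA₂ : A₂ ≤ a₀ ^ 2 + a₀ * X) (hZ : Z₁ = (a₀ + X) + C) (hC : C ≤ κ / 2 * X) :
    Z₁ ≤ (a₀ + X) + κ * ((a₀ + X) - Real.sqrt A₂) := by
  have hsq : Real.sqrt A₂ ≤ a₀ + X / 2 := by
    have h1 : A₂ ≤ (a₀ + X / 2) ^ 2 := by nlinarith [sq_nonneg X]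
    calc Real.sqrt A₂ ≤ Real.sqrt ((a₀ + X / 2) ^ 2) := Real.sqrt_le_sqrt h1
      _ = a₀ + X / 2 := Real.sqrt_sq (by positivity)
  have h2 : κ / 2 * X ≤ κ * ((a₀ + X) - Real.sqrt A₂) := by nlinarith
  linarith

/-- The converse direction of the sandwich: `κ`-interlacing forces the charged trace below `κ ×` the neutral excited trace
(`a₀² ≤ A₂`, i.e. the vacuum contributes to `A₂`). -/
theorem charged_le_excited_of_interlaced {Z₁ A₂ a₀ X C κ : ℝ} (hκ : 0 ≤ κ) (ha₀ : 0 ≤ a₀) (hA₂ : a₀ ^ 2 ≤ A₂)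
    (hZ : Z₁ = (a₀ + X) + C) (hI : Z₁ ≤ (a₀ + X) + κ * ((a₀ + X) - Real.sqrt A₂)) : C ≤ κ * X := by
  have hsq : a₀ ≤ Real.sqrt A₂ := by
    calc a₀ = Real.sqrt (a₀ ^ 2) := (Real.sqrt_sq ha₀).symm
      _ ≤ Real.sqrt A₂ := Real.sqrt_le_sqrt hA₂
  have h2 : κ * ((a₀ + X) - Real.sqrt A₂) ≤ κ * X := by nlinarith
  linarith

end Summit.QuantumFields.YangMills.Cruxes.IRcof.FluxInterlacing

end
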